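import Mathlib
import Literature.MathematicalPhysics.QuantumFieldTheory.YangMillsOS
import Literature.MathematicalPhysics.QuantumFieldTheory.SpeciesLatticeProducts
import Literature.MathematicalPhysics.QuantumFieldTheory.LatticeGaugeProofs
import Literature.MathematicalPhysics.QuantumLattice.WilsonFeynmanHellmann
import Literature.Analysis.Complex.CauchyTaylorBall
import Summits.QuantumFields.YangMills.Theorems.MirrorModularBoostsHypercubicLimitTypedResponseVacuous
import HarnessLib

/-!
# Line `Sketch` (holomorphic coupling response) of crux `HypercubicLimit` — reshape 1:
# Cauchy transfer at ALL orders

Support file for crux `stmt-QuantumFields-16154` (`CoincidenceRotationBootstrap.HypercubicLimit` =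
`MirrorModularBoosts.WeakCouplingHypercubicLimit`), line `Sketch` (card `holomorphic-coupling-response`,
reshape 1: `C⁺` at order one), registered stub `stub_cauchyTransferAll`.

With `μ_k = wilsonMeasure r.ρ (sch.β k)` the Wilson measure of the scheme at step `k` and
`Φ_k(f) U = smearedLatticeField r.curvature.F (box 4 L_k) a_k c_k m_k f (torusLift (sch.side k) U)` the
smeared renormalised curvature field, the order-1 complex-source RESPONSE is
`Q(t) = (∫ Φ_k(f₀) e^{t Φ_k(f₁)} dμ_k) / (∫ e^{t Φ_k(f₁)} dμ_k)` (`t : ℂ`), and its restriction to the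
real axis is the tilted expectation `g(t) = ∫ Φ_k(f₀) d(μ_k.tilted (t Φ_k(f₁)))`.  If `Q` is holomorphic
on the disc `|t| < ε` and bounded there by `B`, then ALL real derivatives of `g` at `0` obey the
`k`-uniform Cauchy bounds `|g⁽ⁿ⁾(0)| ≤ n! B / (ε/2)ⁿ` (these are the joint cumulants
`κ_{n+1}(Φ_k(f₀); Φ_k(f₁)^{×n})`).

Proof: (i) on the real axis `Q ↑t = ↑(g t)` (`response_ofReal`); (ii) Cauchy's inequality from the sup
bound on the ball, `‖Q⁽ⁿ⁾(0)‖ ≤ n! B / (ε/2)ⁿ`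
(`Literature.Analysis.Complex.norm_iteratedDeriv_le_of_forall_mem_ball`); (iii) real versus complex
iterated derivatives along the real axis: by induction on `n`, on the interval `(-ε, ε)` the real
iterated derivative `g⁽ⁿ⁾(x)` is the real part of the complex one `Q⁽ⁿ⁾(↑x)` (`Q` is analytic on the
open ball, so is every `Q⁽ⁿ⁾`, and `HasDerivAt.real_of_complex` transports the complex derivative of
`Q⁽ⁿ⁾` at a real point to the real derivative of `x ↦ (Q⁽ⁿ⁾ ↑x).re`; the induction runs on the open
interval so that `deriv` may be computed from an eventual equality); (iv) `|re z| ≤ ‖z‖`.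

* `cauchyAll_iteratedDeriv_eq_re` — real iterated derivatives of the real restriction of a function
  holomorphic on a ball, as real parts of the complex ones (private helper);
* `cauchyAll_abs_iteratedDeriv_le` — the abstract Cauchy transfer at all orders (private helper);
* `stub_cauchyTransferAll` — the registered stub (tree vocabulary).
-/

noncomputable section

open scoped SchwartzMap
open MeasureTheory ProbabilityTheory Filter Topology
open Literature.MathematicalPhysics.QuantumLattice Literature.MathematicalPhysics.QuantumFieldTheory

namespace Summit.QuantumFields.YangMills.Cruxes.HypercubicLimit.CouplingResponse

/-- **Real versus complex iterated derivatives along the real axis.**  If `Q : ℂ → ℂ` is holomorphic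
on the ball `|t| < ε` and `g : ℝ → ℝ` satisfies `Q ↑t = ↑(g t)` for real `t`, then for every `n` and
every `x ∈ (-ε, ε)` the real iterated derivative `g⁽ⁿ⁾(x)` is the real part of the complex iterated
derivative `Q⁽ⁿ⁾(↑x)` (induction on `n`: every `Q⁽ⁿ⁾` is analytic on the open ball,
`AnalyticOnNhd.iterated_deriv`, and `HasDerivAt.real_of_complex`). [folklore] -/
private theorem cauchyAll_iteratedDeriv_eq_re {Q : ℂ → ℂ} {g : ℝ → ℝ} {ε : ℝ}
    (hQ : DifferentiableOn ℂ Q (Metric.ball 0 ε)) (hg : ∀ t : ℝ, Q (t : ℂ) = ((g t : ℝ) : ℂ))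
    (n : ℕ) : ∀ x ∈ Set.Ioo (-ε) ε, iteratedDeriv n g x = (iteratedDeriv n Q (x : ℂ)).re := by
  have hA : AnalyticOnNhd ℂ Q (Metric.ball 0 ε) := hQ.analyticOnNhd Metric.isOpen_ball
  have hmem : ∀ x ∈ Set.Ioo (-ε) ε, ((x : ℝ) : ℂ) ∈ Metric.ball (0 : ℂ) ε := by
    intro x hx
    rw [Metric.mem_ball, dist_zero_right, Complex.norm_real, Real.norm_eq_abs, abs_lt]
    exact hx
  induction n with
  | zero =>
    intro x _
    rw [iteratedDeriv_zero, iteratedDeriv_zero, hg, Complex.ofReal_re]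
  | succ n ih =>
    intro x hx
    -- the complex side: `Q⁽ⁿ⁾` is analytic on the ball, with derivative `Q⁽ⁿ⁺¹⁾` at `↑x`
    have hAn : AnalyticOnNhd ℂ (iteratedDeriv n Q) (Metric.ball 0 ε) := by
      rw [iteratedDeriv_eq_iterate]
      exact hA.iterated_deriv n
    have hd : HasDerivAt (iteratedDeriv n Q) (iteratedDeriv (n + 1) Q (x : ℂ)) (x : ℂ) := by
      rw [iteratedDeriv_succ]
      exact (hAn _ (hmem x hx)).differentiableAt.hasDerivAt
    have hre : HasDerivAt (fun t : ℝ => (iteratedDeriv n Q (t : ℂ)).re)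
        (iteratedDeriv (n + 1) Q (x : ℂ)).re x := hd.real_of_complex
    -- the real side: `g⁽ⁿ⁾` agrees with `t ↦ (Q⁽ⁿ⁾ ↑t).re` near `x`
    have hev : iteratedDeriv n g =ᶠ[𝓝 x] fun t : ℝ => (iteratedDeriv n Q (t : ℂ)).re :=
      Filter.eventuallyEq_of_mem (Ioo_mem_nhds hx.1 hx.2) fun t ht => ih t ht
    rw [iteratedDeriv_succ, hev.deriv_eq, hre.deriv]

/-- **Cauchy transfer at all orders** (abstract form).  If `Q : ℂ → ℂ` is holomorphic on the disc
`|t| < ε` and bounded there by `B`, and `g : ℝ → ℝ` is its restriction to the real axis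
(`Q ↑t = ↑(g t)`), then `|g⁽ⁿ⁾(0)| ≤ n! B / (ε/2)ⁿ` for every `n`: `g⁽ⁿ⁾(0) = re Q⁽ⁿ⁾(0)`
(`cauchyAll_iteratedDeriv_eq_re`), `|re z| ≤ ‖z‖`, and Cauchy's inequality from the sup bound
(`Literature.Analysis.Complex.norm_iteratedDeriv_le_of_forall_mem_ball`). [folklore] -/
private theorem cauchyAll_abs_iteratedDeriv_le {Q : ℂ → ℂ} {g : ℝ → ℝ} {ε B : ℝ} (hε : 0 < ε)
    (hQ : DifferentiableOn ℂ Q (Metric.ball 0 ε)) (hB : ∀ t ∈ Metric.ball (0 : ℂ) ε, ‖Q t‖ ≤ B)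
    (hg : ∀ t : ℝ, Q (t : ℂ) = ((g t : ℝ) : ℂ)) (n : ℕ) :
    |iteratedDeriv n g 0| ≤ n.factorial * B / (ε / 2) ^ n := by
  have h := Literature.Analysis.Complex.norm_iteratedDeriv_le_of_forall_mem_ball hε hQ hB n
  have h0 : (0 : ℝ) ∈ Set.Ioo (-ε) ε := ⟨by linarith, hε⟩
  rw [cauchyAll_iteratedDeriv_eq_re hQ hg n 0 h0, Complex.ofReal_zero]
  exact (Complex.abs_re_le_norm _).trans h

/-- **Stub `stub_cauchyTransferAll` of line `Sketch` (reshape 1) — Cauchy transfer at all orders.**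
If the order-1 complex-source response `t ↦ (∫ Φ_k(f₀) e^{t Φ_k(f₁)} dμ_k)/(∫ e^{t Φ_k(f₁)} dμ_k)` of
the smeared renormalised curvature field under the Wilson measure `μ_k = wilsonMeasure r.ρ (sch.β k)` is
holomorphic on the disc `|t| < ε` and bounded there by `B`, then every real derivative at `0` of the
tilted expectation `g(t) = ∫ Φ_k(f₀) d(μ_k.tilted (t Φ_k(f₁)))` obeys `|g⁽ⁿ⁾(0)| ≤ n! B / (ε/2)ⁿ`:
on the real axis the response IS `g` (`response_ofReal`), the real iterated derivatives of the
restriction are the real parts of the complex ones (`cauchyAll_iteratedDeriv_eq_re`), and Cauchy's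
inequality on the circle of radius `ε/2` bounds the latter.  Cauchy estimates for the truncated
functions generated by a holomorphic coupling response (standard analyticity bookkeeping, e.g.
B. Simon, The Statistical Mechanics of Lattice Gases I, Princeton 1993, §II.1, §V). [folklore] -/
theorem stub_cauchyTransferAll :
    ∀ (G : Type) [Group G] [TopologicalSpace G] [IsTopologicalGroup G] [CompactSpace G]
      [MeasurableSpace G] [BorelSpace G] (r : LatticeRep G) (sch : SpeciesScheme (YMSpecies G))
      (k : ℕ) (f₀ f₁ : 𝓢(EuclideanSpace ℝ (Fin 4), ℝ)) (ε B : ℝ), 0 < ε →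
      DifferentiableOn ℂ
        (fun t : ℂ =>
          (∫ U, ((smearedLatticeField r.curvature.F
              (Literature.Probability.LatticeModels.box 4 (sch.L k)) (sch.a k) (sch.c r.curvature k)
              (sch.m r.curvature k) f₀ (torusLift (sch.side k) U) : ℝ) : ℂ) *
            Complex.exp (t * ((smearedLatticeField r.curvature.F
              (Literature.Probability.LatticeModels.box 4 (sch.L k)) (sch.a k) (sch.c r.curvature k)
              (sch.m r.curvature k) f₁ (torusLift (sch.side k) U) : ℝ) : ℂ))
            ∂(wilsonMeasure r.ρ (sch.β k) : Measure (GaugeConfig 4 (sch.side k) G))) /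
          ∫ U, Complex.exp (t * ((smearedLatticeField r.curvature.F
              (Literature.Probability.LatticeModels.box 4 (sch.L k)) (sch.a k) (sch.c r.curvature k)
              (sch.m r.curvature k) f₁ (torusLift (sch.side k) U) : ℝ) : ℂ))
            ∂(wilsonMeasure r.ρ (sch.β k) : Measure (GaugeConfig 4 (sch.side k) G)))
        (Metric.ball 0 ε) →
      (∀ t ∈ Metric.ball (0 : ℂ) ε,
        ‖(∫ U, ((smearedLatticeField r.curvature.F
              (Literature.Probability.LatticeModels.box 4 (sch.L k)) (sch.a k) (sch.c r.curvature k)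
              (sch.m r.curvature k) f₀ (torusLift (sch.side k) U) : ℝ) : ℂ) *
            Complex.exp (t * ((smearedLatticeField r.curvature.F
              (Literature.Probability.LatticeModels.box 4 (sch.L k)) (sch.a k) (sch.c r.curvature k)
              (sch.m r.curvature k) f₁ (torusLift (sch.side k) U) : ℝ) : ℂ))
            ∂(wilsonMeasure r.ρ (sch.β k) : Measure (GaugeConfig 4 (sch.side k) G))) /
          ∫ U, Complex.exp (t * ((smearedLatticeField r.curvature.F
              (Literature.Probability.LatticeModels.box 4 (sch.L k)) (sch.a k) (sch.c r.curvature k)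
              (sch.m r.curvature k) f₁ (torusLift (sch.side k) U) : ℝ) : ℂ))
            ∂(wilsonMeasure r.ρ (sch.β k) : Measure (GaugeConfig 4 (sch.side k) G))‖ ≤ B) →
      ∀ n : ℕ, |iteratedDeriv n
          (fun t : ℝ => ∫ U, smearedLatticeField r.curvature.F
            (Literature.Probability.LatticeModels.box 4 (sch.L k)) (sch.a k) (sch.c r.curvature k)
            (sch.m r.curvature k) f₀ (torusLift (sch.side k) U)
          ∂((wilsonMeasure r.ρ (sch.β k) : Measure (GaugeConfig 4 (sch.side k) G)).tilted
            (fun U => t * smearedLatticeField r.curvature.F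
              (Literature.Probability.LatticeModels.box 4 (sch.L k)) (sch.a k) (sch.c r.curvature k)
              (sch.m r.curvature k) f₁ (torusLift (sch.side k) U)))) 0| ≤
        n.factorial * B / (ε / 2) ^ n := by
  intro G _ _ _ _ _ _ r sch k f₀ f₁ ε B hε hQ hB n
  exact cauchyAll_abs_iteratedDeriv_le hε hQ hB (fun t => response_ofReal
    (fun U => smearedLatticeField r.curvature.F
      (Literature.Probability.LatticeModels.box 4 (sch.L k)) (sch.a k) (sch.c r.curvature k)
      (sch.m r.curvature k) f₀ (torusLift (sch.side k) U))
    (fun U => smearedLatticeField r.curvature.F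
      (Literature.Probability.LatticeModels.box 4 (sch.L k)) (sch.a k) (sch.c r.curvature k)
      (sch.m r.curvature k) f₁ (torusLift (sch.side k) U)) t) n

end Summit.QuantumFields.YangMills.Cruxes.HypercubicLimit.CouplingResponse

end
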